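import Summits.KontsevichZagierPeriods.KontsevichZagierPeriods.Theorems.GpcLegendreLemniscatic.Negative.Canonical

/-!
# `GpcLegendreLemniscatic` (stmt-KontsevichZagierPeriods-0280) — line `hyperbola-fibration-conic`: skeleton

Crux (route Grothendieck, rank 5; shared with VeryGoodTransfer, ZeroPortrait, UnfoldedStokes): Legendre's
relation `2E(1/√2)K(1/√2) − K(1/√2)² = π/2` INSIDE the four-move Kontsevich–Zagier calculus, i.e.
`KZ.Equivalent r r'` for the pinned representations `r = [(0,1)², (2e(x₀) − k(x₀))·k(x₁)]` and
`r' = [ℝ, 1/(2(1+x²))]`. By `gpcLegendre_iff` (Theorems/…/Negative/Canonical) it suffices to show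
`Equivalent legendreRep arctanRep` for the canonical pair.

## The line (lead's sharpened form of the card `Ideas/hyperbola-fibration-conic.md`)

Coordinates are written `z 0, z 1` on `Fin 2 → ℝ`.

* M0 `stub_quarticTwist` (port of `Cruxes/…/Disproof.lean` §7): Lawden's `x = √(1 − t²)` in each factor,
  two rule-(2) moves glued by `Equivalent.prod`:
  `legendreRep ~ q = [(0,1)², 2 z0² / (√(1 − z0⁴) · √(1 − z1⁴))]`.
* M1 `stub_fibration`: the ONE-COORDINATE substitution `Ψ₁ z = update z 1 (z0 · z1)` (hyperbola
  fibration `t = x₀x₁`, keeping `y = x₀`), a bijection `(0,1)² → T = {0 < z1 < z0 < 1}` with Jacobian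
  `z0`; rule (2) gives `q ~ [T, 2 z0³ / (√(1 − z0⁴) · √(z0⁴ − z1⁴))]`.
* M2 `stub_pencilCalculus` + `stub_conicPencil`: on each fibre `z1 = t` the conic
  `v² = (1 − u)(u − t⁴)` (`u = y⁴`) is rationalised by `w = √((y⁴ − t⁴)/(1 − y⁴)) ∈ (0, ∞)`; the
  ONE-COORDINATE substitution `Ψ₂ z = update z 0 (w z)` is a bijection `T → H = {0 < z0} × {0 < z1 < 1}`
  with Jacobian `∂w/∂y = 2y³(1 − t⁴)/(w (1 − y⁴)²) > 0`, and since `1 + w² = (1 − t⁴)/(1 − y⁴)` the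
  pull-back identity reads `2y³/(√(1−y⁴)√(y⁴−t⁴)) = (1/(1 + w²)) · |∂w/∂y|` — rule (2) gives
  `[T, …] ~ [H, 1/(1 + z0²)]` (π appears fibrewise as the conic period; no dilation, no swap).
* M3 `stub_stripNewtonLeibniz`: ONE Newton–Leibniz move along the last coordinate `z1 = t`
  (primitive `F z = z1/(1 + z0²)`, edges `0 ≤ t ≤ 1`, closed band vs open strip differ by a null set):
  `[H, 1/(1 + z0²)] ~ [(0,∞), 1/(1 + y²)]`.
* M4 `stub_halfLineTail`: reflection `y ↦ −y` (rule 2), integrand halving (rule 1b), domain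
  additivity `ℝ ∖ {0} = (−∞,0) ∪ (0,∞)` (rule 1a) and the null point:
  `[(0,∞), 1/(1 + y²)] ~ [ℝ, 1/(2(1 + y²))] = arctanRep`.

Every change of variables is a one-coordinate substitution `z ↦ update z k (g z)`, whose Jacobian
determinant is the ordinary derivative of `g` along coordinate `k`
(`Theorems/MzvKernelInKZTwoPosetsInteriorLandenAux1`, `stub_interiorLandenAux1`). Disproof obligations
(Disproof.lean): §2 the four pins enter only through `gpcLegendre_iff`; §3 exactly one NL move (≥ 1 is
necessary); §8 additivity is used (necessary); §4.1 no termwise transfer (the twist mixes `E` and `K`).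

Stubs are stated with EXPLICIT terms (no new definitions), so that each stub file is self-contained.
-/

noncomputable section

open MeasureTheory Set
open Literature.NumberTheory.Transcendental
open Literature.NumberTheory.Transcendental.KZ
open Summit.KontsevichZagierPeriods.KontsevichZagierPeriods.Theses.Grothendieck (GpcLegendreLemniscatic)
open Summit.KontsevichZagierPeriods.Grothendieck.GpcLegendreLemniscaticNegative

namespace Summit.KontsevichZagierPeriods.Grothendieck.GpcLegendreLemniscaticLine

/-- **M0, quartic twist** (port of Disproof §7 `equivalent_legendreRep_lemniscateRep`): the canonical
left representation is equivalent to the lemniscatic product representation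
`[(0,1)², 2z0²/(√(1−z0⁴)√(1−z1⁴))]` (Lawden's `x = √(1−t²)` in each factor, two rule-(2) moves).
[cite: Lawden1989, Ch. 3 Exercise 24 (hint)] -/
theorem stub_quarticTwist :
    ∃ q : IntegralRep 2, q.domain = unitSq ∧
      EqOn q.integrand (fun x => 2 * x 0 ^ 2 / (Real.sqrt (1 - x 0 ^ 4) * Real.sqrt (1 - x 1 ^ 4))) unitSq ∧
      Equivalent legendreRep q := by
  sorry

/-- **M1, hyperbola fibration**: the one-coordinate substitution `z ↦ update z 1 (z 0 * z 1)` is a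
rule-(2) move from `[(0,1)², 2z0²/(√(1−z0⁴)√(1−z1⁴))]` to the triangle representation
`[{0 < z1 < z0 < 1}, 2z0³/(√(1−z0⁴)√(z0⁴−z1⁴))]` (Jacobian `z0`). [cite: KontsevichZagier2001, §1.2 rule (2)] -/
theorem stub_fibration :
    ∀ q : IntegralRep 2, q.domain = unitSq →
      EqOn q.integrand (fun x => 2 * x 0 ^ 2 / (Real.sqrt (1 - x 0 ^ 4) * Real.sqrt (1 - x 1 ^ 4))) unitSq →
      ∃ T : IntegralRep 2, T.domain = {z : Fin 2 → ℝ | 0 < z 1 ∧ z 1 < z 0 ∧ z 0 < 1} ∧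
        EqOn T.integrand (fun z => 2 * z 0 ^ 3 / (Real.sqrt (1 - z 0 ^ 4) * Real.sqrt (z 0 ^ 4 - z 1 ^ 4)))
          {z : Fin 2 → ℝ | 0 < z 1 ∧ z 1 < z 0 ∧ z 0 < 1} ∧
        Equivalent q T := by
  sorry

/-- **M2a, pencil calculus** (pure real analysis of the conic rationalisation
`Ψ₂ z = update z 0 √((z0⁴ − z1⁴)/(1 − z0⁴))` on the triangle `T = {0 < z1 < z0 < 1}`): `Ψ₂` is injective
on `T`, maps `T` onto the half-strip `{0 < z0} ∩ {0 < z1 < 1}`, is differentiable at every point of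
`T` with Jacobian determinant `∂w/∂y = 2z0³(1 − z1⁴)/(w (1 − z0⁴)²)`, and the pull-back identity
`2z0³/(√(1−z0⁴)√(z0⁴−z1⁴)) = (1/(1 + w²))·|∂w/∂y|` holds on `T`. [folklore] -/
theorem stub_pencilCalculus :
    InjOn (fun z : Fin 2 → ℝ => Function.update z 0 (Real.sqrt ((z 0 ^ 4 - z 1 ^ 4) / (1 - z 0 ^ 4))))
        {z : Fin 2 → ℝ | 0 < z 1 ∧ z 1 < z 0 ∧ z 0 < 1} ∧
      (fun z : Fin 2 → ℝ => Function.update z 0 (Real.sqrt ((z 0 ^ 4 - z 1 ^ 4) / (1 - z 0 ^ 4)))) ''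
          {z : Fin 2 → ℝ | 0 < z 1 ∧ z 1 < z 0 ∧ z 0 < 1} = {z : Fin 2 → ℝ | 0 < z 0 ∧ 0 < z 1 ∧ z 1 < 1} ∧
      (∀ z ∈ {z : Fin 2 → ℝ | 0 < z 1 ∧ z 1 < z 0 ∧ z 0 < 1},
        ∃ L : (Fin 2 → ℝ) →L[ℝ] (Fin 2 → ℝ),
          HasFDerivAt (fun z : Fin 2 → ℝ =>
              Function.update z 0 (Real.sqrt ((z 0 ^ 4 - z 1 ^ 4) / (1 - z 0 ^ 4)))) L z ∧
            L.det = 2 * z 0 ^ 3 * (1 - z 1 ^ 4) /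
              (Real.sqrt ((z 0 ^ 4 - z 1 ^ 4) / (1 - z 0 ^ 4)) * (1 - z 0 ^ 4) ^ 2)) ∧
      (∀ z ∈ {z : Fin 2 → ℝ | 0 < z 1 ∧ z 1 < z 0 ∧ z 0 < 1},
        2 * z 0 ^ 3 / (Real.sqrt (1 - z 0 ^ 4) * Real.sqrt (z 0 ^ 4 - z 1 ^ 4)) =
          1 / (1 + Real.sqrt ((z 0 ^ 4 - z 1 ^ 4) / (1 - z 0 ^ 4)) ^ 2) *
            |2 * z 0 ^ 3 * (1 - z 1 ^ 4) /
              (Real.sqrt ((z 0 ^ 4 - z 1 ^ 4) / (1 - z 0 ^ 4)) * (1 - z 0 ^ 4) ^ 2)|) := by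
  sorry

/-- **M2b, conic pencil move**: given the pencil calculus, the substitution `Ψ₂` is ONE rule-(2) move
from the triangle representation to the half-strip representation `[{0 < z0} ∩ {0 < z1 < 1}, 1/(1 + z0²)]`
(semialgebraicity of `Ψ₂`: graph `w > 0 ∧ w²(1 − z0⁴) = z0⁴ − z1⁴`; integrability transported by the
Jacobian formula). [cite: KontsevichZagier2001, §1.2 rule (2)] -/
theorem stub_conicPencil :
    (InjOn (fun z : Fin 2 → ℝ => Function.update z 0 (Real.sqrt ((z 0 ^ 4 - z 1 ^ 4) / (1 - z 0 ^ 4))))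
        {z : Fin 2 → ℝ | 0 < z 1 ∧ z 1 < z 0 ∧ z 0 < 1} ∧
      (fun z : Fin 2 → ℝ => Function.update z 0 (Real.sqrt ((z 0 ^ 4 - z 1 ^ 4) / (1 - z 0 ^ 4)))) ''
          {z : Fin 2 → ℝ | 0 < z 1 ∧ z 1 < z 0 ∧ z 0 < 1} = {z : Fin 2 → ℝ | 0 < z 0 ∧ 0 < z 1 ∧ z 1 < 1} ∧
      (∀ z ∈ {z : Fin 2 → ℝ | 0 < z 1 ∧ z 1 < z 0 ∧ z 0 < 1},
        ∃ L : (Fin 2 → ℝ) →L[ℝ] (Fin 2 → ℝ),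
          HasFDerivAt (fun z : Fin 2 → ℝ =>
              Function.update z 0 (Real.sqrt ((z 0 ^ 4 - z 1 ^ 4) / (1 - z 0 ^ 4)))) L z ∧
            L.det = 2 * z 0 ^ 3 * (1 - z 1 ^ 4) /
              (Real.sqrt ((z 0 ^ 4 - z 1 ^ 4) / (1 - z 0 ^ 4)) * (1 - z 0 ^ 4) ^ 2)) ∧
      (∀ z ∈ {z : Fin 2 → ℝ | 0 < z 1 ∧ z 1 < z 0 ∧ z 0 < 1},
        2 * z 0 ^ 3 / (Real.sqrt (1 - z 0 ^ 4) * Real.sqrt (z 0 ^ 4 - z 1 ^ 4)) =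
          1 / (1 + Real.sqrt ((z 0 ^ 4 - z 1 ^ 4) / (1 - z 0 ^ 4)) ^ 2) *
            |2 * z 0 ^ 3 * (1 - z 1 ^ 4) /
              (Real.sqrt ((z 0 ^ 4 - z 1 ^ 4) / (1 - z 0 ^ 4)) * (1 - z 0 ^ 4) ^ 2)|)) →
    ∀ T : IntegralRep 2, T.domain = {z : Fin 2 → ℝ | 0 < z 1 ∧ z 1 < z 0 ∧ z 0 < 1} →
      EqOn T.integrand (fun z => 2 * z 0 ^ 3 / (Real.sqrt (1 - z 0 ^ 4) * Real.sqrt (z 0 ^ 4 - z 1 ^ 4)))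
          {z : Fin 2 → ℝ | 0 < z 1 ∧ z 1 < z 0 ∧ z 0 < 1} →
      ∃ p : IntegralRep 2, p.domain = {z : Fin 2 → ℝ | 0 < z 0 ∧ 0 < z 1 ∧ z 1 < 1} ∧
        EqOn p.integrand (fun z => 1 / (1 + z 0 ^ 2)) {z : Fin 2 → ℝ | 0 < z 0 ∧ 0 < z 1 ∧ z 1 < 1} ∧
        Equivalent T p := by
  sorry

/-- **M3, Newton–Leibniz along the strip**: ONE rule-(3) move along the last coordinate `z1 = t ∈ [0,1]`
with the primitive `F z = z1/(1 + z0²)` (polynomial in `t`), plus the null faces `t = 0, 1`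
(rule 1a), takes the half-strip representation to the half-line representation `[(0,∞), 1/(1 + y²)]`.
[cite: KontsevichZagier2001, §1.2 rule (3)] -/
theorem stub_stripNewtonLeibniz :
    ∀ p : IntegralRep 2, p.domain = {z : Fin 2 → ℝ | 0 < z 0 ∧ 0 < z 1 ∧ z 1 < 1} →
      EqOn p.integrand (fun z => 1 / (1 + z 0 ^ 2)) {z : Fin 2 → ℝ | 0 < z 0 ∧ 0 < z 1 ∧ z 1 < 1} →
      ∃ a : IntegralRep 1, a.domain = {y : Fin 1 → ℝ | 0 < y 0} ∧
        EqOn a.integrand (fun y => 1 / (1 + y 0 ^ 2)) {y : Fin 1 → ℝ | 0 < y 0} ∧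
        Equivalent p a := by
  sorry

/-- **M4, half-line to line**: `[(0,∞), 1/(1 + y²)] ~ [ℝ, 1/(2(1 + y²))] = arctanRep` by the reflection
`y ↦ −y` (rule 2), halving the integrand (rule 1b), `ℝ ∖ {0} = (−∞,0) ∪ (0,∞)` (rule 1a) and the null
point `{0}`. [cite: KontsevichZagier2001, §1.2 rules (1)–(2)] -/
theorem stub_halfLineTail :
    ∀ a : IntegralRep 1, a.domain = {y : Fin 1 → ℝ | 0 < y 0} →
      EqOn a.integrand (fun y => 1 / (1 + y 0 ^ 2)) {y : Fin 1 → ℝ | 0 < y 0} →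
      Equivalent a arctanRep := by
  sorry

/-- **Composition**: the five moves M0–M4 chain `legendreRep ~ q ~ T ~ p ~ a ~ arctanRep`, and
`gpcLegendre_iff` turns this into the crux. [folklore] -/
theorem GpcLegendreLemniscatic_of : GpcLegendreLemniscatic := by
  obtain ⟨q, hqd, hqi, hq⟩ := stub_quarticTwist
  obtain ⟨T, hTd, hTi, hT⟩ := stub_fibration q hqd hqi
  obtain ⟨p, hpd, hpi, hp⟩ := stub_conicPencil stub_pencilCalculus T hTd hTi
  obtain ⟨a, had, hai, ha⟩ := stub_stripNewtonLeibniz p hpd hpi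
  exact gpcLegendre_iff.mpr (hq.trans (hT.trans (hp.trans (ha.trans (stub_halfLineTail a had hai)))))

end Summit.KontsevichZagierPeriods.Grothendieck.GpcLegendreLemniscaticLine
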